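import Summits.QuantumAdvantage.QuantumAdvantage.Theorems.CubicForrelationNearExactIsExactTwelveTypeO512At2932
import Summits.QuantumAdvantage.QuantumAdvantage.Theorems.CubicForrelationNearExactIsExactTwelveClosedGt2932

/-!
# Crux `CubicForrelation.NearExactIsExact` (stmt-QuantumAdvantage-14043) — n = 12: NO type-O side with the 9-flat base set `512` at `Φ ≥ 29/32`
  (the boundary configuration of …TwelveTypeO512At2932 — `256` wild points — forces the partner to be BENT)

Certificate seat `b2b-cforr-cert` (gen 22).  HONEST FRAMING: a kernel-checked theorem (standard axioms, no `decide`) about cubic Boolean pairs on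
12 bits — the base-`512` configuration of the boundary rung `29/32` is DEAD for every partner type (HOME/b2b-cforr-cert-g22/PLAN-N12-928-EQ.md).
Equivalently: a type-O side whose base set is a 9-flat has `Φ < 29/32` (gen 15: `≤ 931/1024`; gen 19: `≤ 929/1024`; …TwelveTypeO512At2932:
`≤ 29/32`).  NO new value of `θ₁₂` by itself.  NOT summit progress.

`to22_typeO_E512_ge2932_false`.  Proof.  By `to22_typeO_E512_ge2932_dichotomy` (and `to20_typeO_E512_ge929_false`) we are at `Φ = 29/32` with the
wild function `v` of `u − 4(−1)^f = τ₀ + 8v` supported on exactly `256` points, `v = ±1` there with `τ₀ = −3v` — i.e. the wild points lie in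
`E` and `v = (−1)^{d₁}` on them (`d₁` the AFFINE digit, `(−1)^{d₁(x)} = (−1)^{b₁}(−1)^{c₁·x}`).  The cube congruences (`to12_cube_congr`) make the
odd set `S` of `v` a Boolean function of degree `≤ 4` (Möbius), of the minimum weight `256 = 2^{12−4}` of `RM(4,12)`: `S` is an 8-flat `x_S ⊕ V_S`
(`mw_flat_of_minweight`).  Hence `v̂(y) = (−1)^{b₁} Σ_{x∈S} (−1)^{x·(c₁⊕y)} ∈ {0, ±256}` (`sum_twist_subspace`), and likewise `Ê ∈ {0, ±512}`
for the 9-flat `E`.  The partner identity (`to18_typeO_partner_identity`) then reads `64u_f = 256(−1)^g − (−1)^{b₁}(4096[y=c₁] − 4Ê) − 8v̂` with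
every term on the right except `256(−1)^g` divisible by `512`: `u_f = 4w` with `w ≡ (−1)^g` odd EVERYWHERE, so `W_f = 64w`, `Σ w² = 4096` forces
`|W_f| = 64`: `f` is bent, and `tw_bent_end` gives `Φ ∈ {1} ∪ [0, 7/8]` — not `29/32`.

References: J. Ax (1964) / R. J. McEliece (1972); O. S. Rothaus (1976); Kasami–Tokura (1970); MacWilliams–Sloane (1977) Ch. 13–15.  Axioms: the
standard three.
-/

set_option linter.dupNamespace false -- D-0017: single-problem summit ⇒ `QuantumAdvantage.QuantumAdvantage` by design

noncomputable section

namespace Summit.QuantumAdvantage.QuantumAdvantage.Theorems.CubicForrelation.NearExactIsExact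

open Finset
open Literature.Computability.QuantumComplexity
open Literature.Computability.QuantumComplexity.BuzetChailloux (bxor zeroVec bxor_bxor_cancel_left bxor_zeroVec zeroVec_bxor bxor_comm
  bxor_self twist_zeroVec_right twist_bxor_right)
open Literature.Computability.QuantumComplexity.DerivativeWalsh (W twist_bxor_left sum_twist_subspace)
open Literature.Computability.QuantumComplexity.Simon (twist_eq_one_or)
open Summit.QuantumAdvantage.QuantumAdvantage.Theorems.NearExactIsExact.Negative (TypeOTwelve.typeO_of_exists_odd)

/-- **No type-O side with base set `512` at `Φ ≥ 29/32`** (12 bits): cubic `f, g`, `W_g = 16u` with some `u` odd, `#E = 512`,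
`Φ(f,g) ≥ 29/32` is impossible.  See the module docstring.  Finite-slice statement, NOT summit progress. [this work] -/
theorem to22_typeO_E512_ge2932_false (f g : (Fin (6 + 6) → Bool) → Bool) (hf : IsDegLeFun 3 f) (hg : IsDegLeFun 3 g)
    (u : (Fin (6 + 6) → Bool) → ℤ) (hu : ∀ x, W (fun y => signOf (g y)) x = (2 : ℝ) ^ 4 * (u x : ℝ))
    (hodd : ∃ x, Odd (u x)) (hE512 : #(univ.filter fun x : Fin (6 + 6) → Bool => (Odd (u x / 2) ↔ Odd (u x / 2 / 2))) = 512)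
    (hΦ : (29 / 32 : ℝ) ≤ forrelation f g) : False := by
  classical
  have hΦ' : forrelation g f = forrelation f g := by
    rw [Summit.QuantumAdvantage.QuantumAdvantage.Theorems.SignedCubicForrelationNotPrBPP.Negative.HalfQuad.forrelation_comm]
  rcases to22_typeO_E512_ge2932_dichotomy f g hf hg u hu hodd hE512 hΦ with h929 | ⟨hΦeq, v, hv, hvval, hcard⟩
  · exact to20_typeO_E512_ge929_false f g hf hg u hu hodd hE512 h929
  -- the digits, the 9-flat `E`, the wild identity in coset form, the cube congruences
  have hall : ∀ x, Odd (u x) := TypeOTwelve.typeO_of_exists_odd g u hg hu hodd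
  have hu' : ∀ x, W (fun y => signOf (g y)) x = (2 : ℝ) ^ (2 * 2) * (u x : ℝ) := fun x => (hu x).trans (by norm_num)
  have hd1 : IsDegLeFun 1 (fun x => decide (Odd (u x / 2))) := z2_digitOne 2 g u hg hu' hall
  have hd2 : IsDegLeFun 3 (fun x => decide (Odd (u x / 2 / 2))) := z2_digitTwo 2 g u hg hu' hall
  obtain ⟨c₁, b₁, hcb⟩ := stub_affineForm (6 + 6) _ hd1
  set E := univ.filter (fun x : Fin (6 + 6) → Bool => (Odd (u x / 2) ↔ Odd (u x / 2 / 2))) with hEdef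
  have hmemE : ∀ x, x ∈ E ↔ (Odd (u x / 2) ↔ Odd (u x / 2 / 2)) := fun x => by simp [hEdef]
  have hdegE : IsDegLeFun (2 + 1) (fun x => (decide (Odd (u x / 2)) ^^ decide (Odd (u x / 2 / 2))) ^^ true) :=
    tb_isDegLeFun_xor_const (bb_isDegLeFun_bxor (hd1.mono (by norm_num)) hd2) true
  have hsetE : (univ.filter fun x : Fin (6 + 6) → Bool =>
      ((decide (Odd (u x / 2)) ^^ decide (Odd (u x / 2 / 2))) ^^ true) = true) = E := by
    rw [hEdef]
    apply filter_congr
    intro x _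
    by_cases h1 : Odd (u x / 2) <;> by_cases h2 : Odd (u x / 2 / 2) <;> simp [h1, h2]
  have hmwE := mw_flat_of_minweight 2 _ hdegE (by rw [hsetE, hE512]; norm_num)
  rw [hsetE] at hmwE
  obtain ⟨h0E, haddE, hcardVE, hcosetE⟩ := hmwE
  set VE := univ.filter (fun a : Fin (6 + 6) → Bool => ∀ x,
    ((decide (Odd (u (bxor x a) / 2)) ^^ decide (Odd (u (bxor x a) / 2 / 2))) ^^ true) =
      ((decide (Odd (u x / 2)) ^^ decide (Odd (u x / 2 / 2))) ^^ true)) with hVE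
  rw [hE512] at hcardVE
  obtain ⟨xE, hxE⟩ : E.Nonempty := card_pos.1 (by rw [hE512]; norm_num)
  have hSE : E = VE.image (bxor xE) := hcosetE xE (by
    have h := (hmemE xE).1 hxE
    by_cases h1 : Odd (u xE / 2)
    · have h2 : Odd (u xE / 2 / 2) := h.1 h1
      simp [h1, h2]
    · have h2 : ¬ Odd (u xE / 2 / 2) := fun h' => h1 (h.2 h')
      simp [h1, h2])
  have hv' : ∀ x, u x - 4 * sZ (f x) =
      sZ (decide (Odd (u x / 2))) * (1 - 4 * (if x ∈ VE.image (bxor xE) then 1 else 0)) + 8 * v x := by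
    intro x
    rw [← hSE, hv x]
    by_cases hx : (Odd (u x / 2) ↔ Odd (u x / 2 / 2))
    · rw [if_pos hx, if_pos ((hmemE x).2 hx)]
    · rw [if_neg hx, if_neg (fun h' => hx ((hmemE x).1 h'))]
  have hcc := fun I => to12_cube_congr f g hf hg u hu hd1 VE xE h0E haddE hcardVE v hv' I
  -- the odd set `S` of `v` has degree `≤ 4` and `256` points: an 8-flat
  have hdeg4 : IsDegLeFun 4 (fun x => decide (Odd (v x))) := by
    refine bb_moebius_isDegLeFun 4 _ fun I hI => ?_
    have hE := (tw_even_sum_iff _ v).1 (even_iff_two_dvd.2 ((hcc I).1 (by omega)))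
    rw [filter_filter] at hE
    simpa only [decide_eq_true_eq] using hE
  set S := univ.filter (fun x : Fin (6 + 6) → Bool => decide (Odd (v x)) = true) with hSdef
  have hmemS : ∀ x, x ∈ S ↔ v x ≠ 0 := by
    intro x
    rw [hSdef, mem_filter]
    rcases hvval x with h | ⟨h, -⟩
    · simp [h]
    · rcases h with h | h <;> simp [h]
  have hScard : #S = 256 := by
    have e : S = univ.filter (fun x => v x ≠ 0) := by ext x; rw [hmemS, mem_filter]; simp
    rw [e, hcard]
  have hmwS := mw_flat_of_minweight 3 (fun x => decide (Odd (v x))) hdeg4 (by rw [← hSdef, hScard]; norm_num)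
  rw [← hSdef] at hmwS
  obtain ⟨hS0, hSadd, hScardV, hScoset⟩ := hmwS
  set VS := univ.filter (fun a : Fin (6 + 6) → Bool => ∀ x, decide (Odd (v (bxor x a))) = decide (Odd (v x))) with hVSdef
  obtain ⟨xS, hxS⟩ : S.Nonempty := card_pos.1 (by rw [hScard]; norm_num)
  have hSimg : S = VS.image (bxor xS) := hScoset xS (mem_filter.1 hxS).2
  -- on `S`, `v = (−1)^{d₁} = (−1)^{b₁}(−1)^{c₁·x}`
  have hvS : ∀ x, v x ≠ 0 → (v x : ℝ) = signOf b₁ * twist c₁ x := by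
    intro x hx
    rcases hvval x with h0 | ⟨h1, hτ⟩
    · exact absurd h0 hx
    have hvd : v x = sZ (decide (Odd (u x / 2))) := by
      rcases tp_sZ_cases (decide (Odd (u x / 2))) with hs | hs <;> rw [hs] at hτ ⊢ <;> split_ifs at hτ <;> omega
    rw [hvd, tp_sZ_cast, hcb x]
  -- character sums of flats: `v̂ ∈ {0, ±256}·`, `Ê ∈ {0, ±512}`
  have hflat : ∀ (T V₀ : Finset (Fin (6 + 6) → Bool)) (x₀ : Fin (6 + 6) → Bool),
      (∀ a ∈ V₀, ∀ b ∈ V₀, bxor a b ∈ V₀) → T = V₀.image (bxor x₀) → ∀ z,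
      ∃ ι : ℤ, (ι = 0 ∨ ι = 1 ∨ ι = -1) ∧ ∑ x ∈ T, twist x z = (#V₀ : ℝ) * (ι : ℝ) := by
    intro T V₀ x₀ hadd hT z
    have h1 : ∑ x ∈ T, twist x z = twist x₀ z * ∑ a ∈ V₀, twist a z := by
      rw [hT, sum_image (fun a _ b _ h => by
        have := congrArg (bxor x₀) h; rwa [bxor_bxor_cancel_left, bxor_bxor_cancel_left] at this), mul_sum]
      exact sum_congr rfl fun a _ => twist_bxor_left x₀ a z
    rw [h1, sum_twist_subspace hadd]
    split_ifs with hperp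
    · rcases twist_eq_one_or x₀ z with h | h
      · exact ⟨1, Or.inr (Or.inl rfl), by rw [h]; push_cast; ring⟩
      · exact ⟨-1, Or.inr (Or.inr rfl), by rw [h]; push_cast; ring⟩
    · exact ⟨0, Or.inl rfl, by simp⟩
  have hvhat : ∀ y, ∃ ι : ℤ, ∑ x, (v x : ℝ) * twist x y = 256 * (ι : ℝ) := by
    intro y
    have h1 : ∑ x, (v x : ℝ) * twist x y = ∑ x ∈ S, signOf b₁ * twist c₁ x * twist x y := by
      rw [← sum_subset (subset_univ S) (fun x _ hx => by
        have : v x = 0 := by by_contra h; exact hx ((hmemS x).2 h)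
        rw [this]; simp)]
      exact sum_congr rfl fun x hx => by rw [hvS x ((hmemS x).1 hx)]
    have h2 : ∑ x ∈ S, signOf b₁ * twist c₁ x * twist x y = signOf b₁ * ∑ x ∈ S, twist x (bxor c₁ y) := by
      rw [mul_sum]
      exact sum_congr rfl fun x _ => by rw [twist_bxor_right, twist_comm c₁ x]; ring
    obtain ⟨ι, -, hι⟩ := hflat S VS xS hSadd hSimg (bxor c₁ y)
    rw [h1, h2, hι, hScardV, hScard]
    rcases tp_sZ_cases b₁ with hs | hs
    · refine ⟨ι, ?_⟩
      rw [← tp_sZ_cast, hs]; push_cast; ring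
    · refine ⟨-ι, ?_⟩
      rw [← tp_sZ_cast, hs]; push_cast; ring
  have hEhat : ∀ z, ∃ κ : ℤ, ∑ x ∈ E, twist x z = 512 * (κ : ℝ) := by
    intro z
    obtain ⟨κ, -, hκ⟩ := hflat E VE xE haddE hSE z
    exact ⟨κ, by rw [hκ, hcardVE]; push_cast; ring⟩
  -- the partner: `u_f = 4 w` with `w` odd everywhere
  obtain ⟨uf, huf⟩ := tw_base (n := 6 + 6) f hf 4 (by norm_num)
  have hsb : ((sZ b₁ : ℤ) : ℝ) = signOf b₁ := tp_sZ_cast _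
  have hw : ∀ y, ∃ w : ℤ, uf y = 4 * w ∧ Odd w := by
    intro y
    have h := to18_typeO_partner_identity f g u hu v hv c₁ b₁ hcb uf huf y
    rw [← hEdef] at h
    obtain ⟨ι, hι⟩ := hvhat y
    obtain ⟨κ, hκ⟩ := hEhat (bxor c₁ y)
    rw [hι, hκ] at h
    have hsg := tp_sZ_cast (g y)
    refine ⟨sZ (g y) - 16 * sZ b₁ * (if bxor c₁ y = (fun _ => false) then 1 else 0) + 8 * sZ b₁ * κ - 8 * ι, ?_, ?_⟩
    · have h' : ((uf y : ℤ) : ℝ) = ((4 * (sZ (g y) - 16 * sZ b₁ * (if bxor c₁ y = (fun _ => false) then 1 else 0) +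
          8 * sZ b₁ * κ - 8 * ι) : ℤ) : ℝ) := by
        rcases tp_sZ_cases b₁ with hs | hs
        all_goals
          rw [hs] at hsb ⊢
          push_cast at hsb h ⊢
          rw [← hsb, ← hsg] at h
          split_ifs with hz
          · rw [if_pos hz] at h
            have e4096 : (2 : ℝ) ^ (6 + 6) = 4096 := by norm_num
            rw [e4096] at h
            linarith
          · rw [if_neg hz] at h
            linarith
      exact_mod_cast h'
    · have hodd1 : Odd (sZ (g y)) := by rcases tp_sZ_cases (g y) with hs | hs <;> rw [hs] <;> decide
      have hev : Even (- (16 * sZ b₁ * (if bxor c₁ y = (fun _ => false) then 1 else 0)) + 8 * sZ b₁ * κ - 8 * ι : ℤ) :=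
        ⟨-(8 * sZ b₁ * (if bxor c₁ y = (fun _ => false) then 1 else 0)) + 4 * sZ b₁ * κ - 4 * ι, by ring⟩
      have := hodd1.add_even hev
      convert this using 1
      ring
  choose w hw4 hwodd using hw
  have hwf : ∀ y, W (fun x => signOf (f x)) y = (2 : ℝ) ^ 6 * (w y : ℝ) := by
    intro y; rw [huf y, hw4 y]; push_cast; ring
  -- `f` is bent: Parseval with `w` odd everywhere
  set u4 : (Fin (6 + 6) → Bool) → ℤ := fun y => 4 * w y with hu4def
  have hu4 : ∀ y, W (fun x => signOf (f x)) y = (2 : ℝ) ^ 4 * (u4 y : ℝ) := by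
    intro y; rw [hwf y]; simp only [u4]; push_cast; ring
  have hpar : ∑ y, w y ^ 2 = 4096 := by
    have h := zms_sum_u_sq 2 f u4 (fun y => (hu4 y).trans (by norm_num))
    have e : ∑ y, ((u4 y : ℝ)) ^ 2 = 16 * ∑ y, ((w y : ℝ)) ^ 2 := by
      rw [mul_sum]; exact sum_congr rfl fun y _ => by simp only [u4]; push_cast; ring
    rw [e] at h
    norm_num at h
    have h' : ∑ y, ((w y : ℝ)) ^ 2 = 4096 := by linarith
    exact_mod_cast h'
  have hsq1' : ∀ y, w y ^ 2 = 1 := by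
    have hge : ∀ y, (1 : ℤ) ≤ w y ^ 2 := fun y => by
      have h0 := Int.odd_iff.1 (hwodd y)
      have : w y ≤ -1 ∨ 1 ≤ w y := by omega
      have := tp_sq_ge (k := 1) (by norm_num) this
      linarith
    have hsum0 : ∑ y, (w y ^ 2 - 1 : ℤ) = 0 := by
      rw [sum_sub_distrib, hpar, sum_const, card_univ, Fintype.card_fun, Fintype.card_bool, Fintype.card_fin]; norm_num
    intro y
    have := (sum_eq_zero_iff_of_nonneg fun z _ => by have := hge z; linarith).1 hsum0 y (mem_univ y)
    linarith
  have hbent : ∀ y, W (fun x => signOf (f x)) y ^ 2 = (2 : ℝ) ^ (6 + 6) := by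
    intro y
    rw [hwf y, mul_pow]
    have : ((w y : ℝ)) ^ 2 = 1 := by exact_mod_cast hsq1' y
    rw [this]; norm_num
  rcases tw_bent_end (by norm_num) g f hg hf hbent with h | h
  · rw [hΦ', hΦeq] at h; norm_num at h
  · rw [hΦ', hΦeq] at h; norm_num at h

/-- **A type-O side whose base set is a 9-flat has `Φ < 29/32`** (12 bits).  NOT summit progress. [this work] -/
theorem to22_typeO_E512_lt_2932 (f g : (Fin (6 + 6) → Bool) → Bool) (hf : IsDegLeFun 3 f) (hg : IsDegLeFun 3 g)
    (u : (Fin (6 + 6) → Bool) → ℤ) (hu : ∀ x, W (fun y => signOf (g y)) x = (2 : ℝ) ^ 4 * (u x : ℝ))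
    (hodd : ∃ x, Odd (u x)) (hE512 : #(univ.filter fun x : Fin (6 + 6) → Bool => (Odd (u x / 2) ↔ Odd (u x / 2 / 2))) = 512) :
    forrelation f g < 29 / 32 := by
  by_contra h
  push Not at h
  exact to22_typeO_E512_ge2932_false f g hf hg u hu hodd hE512 h

end Summit.QuantumAdvantage.QuantumAdvantage.Theorems.CubicForrelation.NearExactIsExact

end
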